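import Literature.Barriers.AtomisticToContinuum.OneDimensionalHardCoreRodsDensity
import HarnessLib

/-!
# Hard rods, Part H′: the majorant in compressed coordinates and its vanishing

`Literature/Barriers/AtomisticToContinuum/` (D-0021 barrier catalogue), sub-problem
`BoseEinsteinCondensation`; part of the typed proof of the rod barrier `OneDimensionalHardRods`
(`OneDimensionalHardCoreRods.lean`, eighth audit of `OneDimensionalHardCore`, 2026-08-16).

Step (6) of the paper proof, in compressed coordinates. With `L' = L − Na` and packing fraction
`η = ρa < 1/2`, the phase weights of the deficiency bound are uniformly positive:
`|1 + c_l|² = 4cos²(π(n−2l)a/(2L')) ≥ 4cos²θ` whenever `πna/(2L') ≤ θ ≤ π/2`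
(`norm_sq_one_add_rodPhase_ge`; along `L' = N(1/ρ − a)` one may take `θ = θ_η = πη/(2(1−η)) < π/2`),
so `S_{n+1} ≥ 4cos²θ · H_{n+1}` (`rodHarmonic_ge`) and the compressed density is dominated on the
whole `t`-range `[0, L' + a]` by an explicit majorant (`rodCompressedDensity_le_rodMajorant`):
on `[a, L']` by the Gaussian bound of `OneDimensionalHardCoreRodsDensity.lean`, and on the two edge
pieces `[0, a)`, `(L', L'+a]` — where no / all spectators are crossed — by comparison with the
Girardeau density matrix at zero range (`rodCompressedDensity_le_edge_left/right`, translation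
invariance `girardeauState_add_const`). Finally `L'⁻¹∫₀^{L'+a}` of the majorant tends to `0`
along `L'_n = (n+1)ℓ`, `ℓ > 0` (`tendsto_rodMajorant_integral`: substitution and dominated
convergence, the integrand tending to `0` off `sin(πv) = 0`).

## References

* [ForresterEtAl2003] P. J. Forrester et al., Phys. Rev. A 67 (2003) 043607: §2.1.4, §2.2.2.
* [MazzantiEtAl2008] F. Mazzanti et al., Phys. Rev. Lett. 100 (2008) 020401: Eqs. (2)–(3), p. 4.
-/

noncomputable section

open MeasureTheory Finset Complex Matrix Filter Topology
open scoped BigOperators Real ComplexConjugate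

namespace Literature.Barriers.AtomisticToContinuum.BoseGas

section Majorant

variable {n : ℕ} {Lp a t : ℝ}

/-! #### Continuity and translation invariance of the Girardeau state -/

/-- The Girardeau state is continuous. [folklore] -/
theorem continuous_girardeauState (N : ℕ) (L : ℝ) : Continuous (girardeauState N L) := by
  unfold girardeauState
  refine continuous_const.mul (continuous_finsetProd _ fun j _ => ?_)
  refine continuous_finsetProd _ fun k _ => continuous_const.mul ?_
  have hk : Continuous fun x : Fin N → ℝ => Real.pi * (x k - x j) / L := by fun_prop
  exact (Real.continuous_sin.comp hk).abs

/-- `X ↦ snoc X c` is continuous. [folklore] -/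
theorem continuous_snoc_const (c : ℝ) : Continuous fun X : Fin n → ℝ => (Fin.snoc X c : Fin (n + 1) → ℝ) := by
  refine continuous_pi fun i => ?_
  refine Fin.lastCases ?_ (fun j => ?_) i
  · simp only [Fin.snoc_last]; exact continuous_const
  · simp only [Fin.snoc_castSucc]; exact continuous_apply j

/-- The Girardeau state is invariant under a common translation of all particles. [folklore] -/
theorem girardeauState_add_const (N : ℕ) (L : ℝ) (x : Fin N → ℝ) (c : ℝ) :
    girardeauState N L (fun j => x j + c) = girardeauState N L x := by
  unfold girardeauState
  congr 1
  refine Finset.prod_congr rfl fun j _ => Finset.prod_congr rfl fun k _ => ?_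
  rw [show x k + c - (x j + c) = x k - x j by ring]

/-- `snoc (w + a) t = (snoc w (t − a)) + a`. [folklore] -/
theorem snoc_add_const (w : Fin n → ℝ) (c s : ℝ) :
    (Fin.snoc (fun i => w i + c) s : Fin (n + 1) → ℝ) =
      fun j => (Fin.snoc w (s - c) : Fin (n + 1) → ℝ) j + c := by
  funext j
  refine Fin.lastCases ?_ (fun i => ?_) j
  · simp [Fin.snoc_last]
  · simp [Fin.snoc_castSucc]

/-- The two-point Girardeau integrand is integrable on every box. [folklore] -/
theorem integrableOn_girardeau_pair (L c c' : ℝ) (s : Set (Fin n → ℝ)) (hs : volume s < ⊤) :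
    IntegrableOn (fun X : Fin n → ℝ => girardeauState (n + 1) L (Fin.snoc X c) *
      girardeauState (n + 1) L (Fin.snoc X c')) s := by
  have hc : Continuous fun X : Fin n → ℝ => girardeauState (n + 1) L (Fin.snoc X c) *
      girardeauState (n + 1) L (Fin.snoc X c') :=
    ((continuous_girardeauState (n + 1) L).comp (continuous_snoc_const c)).mul
      ((continuous_girardeauState (n + 1) L).comp (continuous_snoc_const c'))
  -- a crude uniform bound: `|ψ| ≤ (√(N! L^N))⁻¹ 2^{N²}`
  set B : ℝ := (Real.sqrt ((n + 1).factorial * L ^ (n + 1)))⁻¹ * 2 ^ ((n + 1) * (n + 1)) with hB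
  have hone : ∀ Y : Fin (n + 1) → ℝ, |girardeauState (n + 1) L Y| ≤ B := by
    intro Y
    rw [abs_of_nonneg (girardeauState_nonneg _ _ _), hB]
    unfold girardeauState
    refine mul_le_mul_of_nonneg_left ?_ (inv_nonneg.mpr (Real.sqrt_nonneg _))
    calc ∏ j : Fin (n + 1), ∏ k : Fin (n + 1) with j < k, 2 * |Real.sin (Real.pi * (Y k - Y j) / L)|
        ≤ ∏ j : Fin (n + 1), ∏ k : Fin (n + 1) with j < k, (2 : ℝ) := by
          refine Finset.prod_le_prod (fun j _ => Finset.prod_nonneg fun k _ => by positivity)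
            fun j _ => Finset.prod_le_prod (fun k _ => by positivity) fun k _ => ?_
          have := Real.abs_sin_le_one (Real.pi * (Y k - Y j) / L)
          linarith
      _ ≤ ∏ _j : Fin (n + 1), (2 : ℝ) ^ (n + 1) := by
          refine Finset.prod_le_prod (fun j _ => Finset.prod_nonneg fun k _ => by positivity)
            fun j _ => ?_
          rw [Finset.prod_const]
          exact pow_le_pow_right₀ (by norm_num) ((Finset.card_filter_le _ _).trans (by simp))
      _ = 2 ^ ((n + 1) * (n + 1)) := by
          rw [Finset.prod_const, Finset.card_univ, Fintype.card_fin, ← pow_mul]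
  have hbd : ∀ X, ‖girardeauState (n + 1) L (Fin.snoc X c) *
      girardeauState (n + 1) L (Fin.snoc X c')‖ ≤ B * B := by
    intro X
    rw [norm_mul, Real.norm_eq_abs, Real.norm_eq_abs]
    exact mul_le_mul (hone _) (hone _) (abs_nonneg _) ((abs_nonneg _).trans (hone (Fin.snoc X c)))
  haveI : IsFiniteMeasure (volume.restrict s) := ⟨by rwa [Measure.restrict_apply_univ]⟩
  exact Integrable.mono' (integrable_const _) hc.aestronglyMeasurable
    (Filter.Eventually.of_forall hbd)

/-! #### The edge pieces -/

/-- Volume of a box of copies of a set of finite measure is finite. [folklore] -/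
theorem volume_pi_lt_top {s : Set ℝ} (hs : volume s < ⊤) :
    volume (Set.pi Set.univ fun _ : Fin n => s) < ⊤ := by
  rw [volume_pi, Measure.pi_pi]
  exact ENNReal.prod_lt_top fun _ _ => hs

/-- **Left edge** (`0 ≤ t < a`: no spectator is crossed):
`ρ̃_{n+1}(t) ≤ ρ^{TG}_{n+1}(0, t)` on the compressed ring. [folklore] -/
theorem rodCompressedDensity_le_edge_left (ht0 : 0 ≤ t) (hta : t < a) :
    rodCompressedDensity n Lp a t ≤ girardeauDensityMatrix (n + 1) Lp 0 t := by
  have hD : rodDomain Lp a t = Set.Ioc t Lp := by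
    unfold rodDomain
    rw [Set.Icc_eq_empty (by linarith), Set.empty_union]
  unfold rodCompressedDensity
  show (n + 1 : ℝ) * _ ≤ (n + 1 : ℝ) * ∫ X in Set.pi Set.univ (fun _ : Fin n => Set.Icc (0 : ℝ) Lp),
    girardeauState (n + 1) Lp (Fin.snoc X 0) * girardeauState (n + 1) Lp (Fin.snoc X t)
  refine mul_le_mul_of_nonneg_left ?_ (by positivity)
  rw [hD]
  have hpt : ∀ w ∈ Set.pi Set.univ (fun _ : Fin n => Set.Ioc t Lp),
      girardeauState (n + 1) Lp (Fin.snoc w 0) *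
          girardeauState (n + 1) Lp (Fin.snoc (fun i => rodShift a t (w i)) t) =
        girardeauState (n + 1) Lp (Fin.snoc w 0) * girardeauState (n + 1) Lp (Fin.snoc w t) := by
    intro w hw
    have hT : (fun i => rodShift a t (w i)) = w := by
      funext i
      have hi : t < w i := (hw i (Set.mem_univ _)).1
      have hni : ¬ w i ≤ t - a := not_le.mpr (by linarith)
      simp only [rodShift, if_neg hni]
    rw [hT]
  rw [setIntegral_congr_fun (MeasurableSet.univ_pi fun _ => measurableSet_Ioc) hpt]
  refine setIntegral_mono_set
    (integrableOn_girardeau_pair Lp 0 t _ (volume_pi_lt_top (by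
      rw [Real.volume_Icc]; exact ENNReal.ofReal_lt_top)))
    (Filter.Eventually.of_forall fun X => mul_nonneg (girardeauState_nonneg _ _ _)
      (girardeauState_nonneg _ _ _))
    (Filter.Eventually.of_forall (Set.pi_mono fun _ _ => Set.Ioc_subset_Icc_self.trans
      (Set.Icc_subset_Icc ht0 le_rfl)))

/-- **Right edge** (`L' < t ≤ L' + a`, `a ≤ L'`: every spectator is crossed):
`ρ̃_{n+1}(t) ≤ ρ^{TG}_{n+1}(0, t − a)`. [folklore] -/
theorem rodCompressedDensity_le_edge_right (hLt : Lp < t) (htLa : t ≤ Lp + a) :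
    rodCompressedDensity n Lp a t ≤ girardeauDensityMatrix (n + 1) Lp 0 (t - a) := by
  have hD : rodDomain Lp a t = Set.Icc 0 (t - a) := by
    unfold rodDomain
    rw [Set.Ioc_eq_empty (not_lt.mpr hLt.le), Set.union_empty]
  unfold rodCompressedDensity
  show (n + 1 : ℝ) * _ ≤ (n + 1 : ℝ) * ∫ X in Set.pi Set.univ (fun _ : Fin n => Set.Icc (0 : ℝ) Lp),
    girardeauState (n + 1) Lp (Fin.snoc X 0) * girardeauState (n + 1) Lp (Fin.snoc X (t - a))
  refine mul_le_mul_of_nonneg_left ?_ (by positivity)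
  rw [hD]
  have hpt : ∀ w ∈ Set.pi Set.univ (fun _ : Fin n => Set.Icc 0 (t - a)),
      girardeauState (n + 1) Lp (Fin.snoc w 0) *
          girardeauState (n + 1) Lp (Fin.snoc (fun i => rodShift a t (w i)) t) =
        girardeauState (n + 1) Lp (Fin.snoc w 0) *
          girardeauState (n + 1) Lp (Fin.snoc w (t - a)) := by
    intro w hw
    have hT : (fun i => rodShift a t (w i)) = fun i => w i + a := by
      funext i
      have hi : w i ≤ t - a := (hw i (Set.mem_univ _)).2
      simp only [rodShift, if_pos hi]
    rw [hT, snoc_add_const, girardeauState_add_const]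
  rw [setIntegral_congr_fun (MeasurableSet.univ_pi fun _ => measurableSet_Icc) hpt]
  refine setIntegral_mono_set
    (integrableOn_girardeau_pair Lp 0 (t - a) _ (volume_pi_lt_top (by
      rw [Real.volume_Icc]; exact ENNReal.ofReal_lt_top)))
    (Filter.Eventually.of_forall fun X => mul_nonneg (girardeauState_nonneg _ _ _)
      (girardeauState_nonneg _ _ _))
    (Filter.Eventually.of_forall (Set.pi_mono fun _ _ => Set.Icc_subset_Icc le_rfl (by linarith)))

/-- On `[0, L']` the zero-range Girardeau density matrix is at most `(N/L') e^{1/2}`. [folklore] -/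
theorem girardeauDensityMatrix_le_crude (hLp : 0 < Lp) {s : ℝ} (hs : s ∈ Set.Icc 0 Lp) :
    girardeauDensityMatrix (n + 1) Lp 0 s ≤ (n + 1 : ℝ) / Lp * Real.exp (1 / 2) := by
  have h0 : (0 : ℝ) ∈ Set.Icc 0 Lp := ⟨le_rfl, hLp.le⟩
  refine (girardeauDensityMatrix_le_exp_numVar hLp h0 hs).trans ?_
  have hV : 0 ≤ numVar (n + 1) Lp 0 s :=
    le_trans (mul_nonneg (by positivity) (Finset.sum_nonneg fun j _ => by positivity))
      (numVar_ge_harmonic hLp h0 hs (n + 1))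
  have hexp : Real.exp (-2 * numVar (n + 1) Lp 0 s) ≤ 1 := by
    rw [Real.exp_le_one_iff]; linarith
  calc (n + 1 : ℝ) / Lp * Real.exp (1 / 2) * Real.exp (-2 * numVar (n + 1) Lp 0 s)
      ≤ (n + 1 : ℝ) / Lp * Real.exp (1 / 2) * 1 := by gcongr
    _ = (n + 1 : ℝ) / Lp * Real.exp (1 / 2) := mul_one _

/-! #### The phase weights at packing fraction below one half -/

/-- **Uniform positivity of the phase weights.** If `πna/(2L') ≤ θ ≤ π/2` then
`4cos²θ ≤ |1 + c_l|²` for every `l ≤ n` (`|1 + c_l|² = 4cos²(π(n−2l)a/(2L'))`, `|n − 2l| ≤ n`,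
and `cos` is even and decreasing on `[0, π]`). [folklore] -/
theorem norm_sq_one_add_rodPhase_ge (hLp : 0 < Lp) (ha : 0 ≤ a) {θ : ℝ}
    (hθ1 : π * n * a / (2 * Lp) ≤ θ) (hθ2 : θ ≤ π / 2) (l : Fin (n + 1)) :
    4 * Real.cos θ ^ 2 ≤ ‖1 + rodPhase n Lp a l‖ ^ 2 := by
  rw [norm_sq_one_add_rodPhase]
  set φ : ℝ := π * ((n : ℝ) - 2 * ((l : ℕ) : ℝ)) * a / (2 * Lp) with hφ
  have hθ0 : 0 ≤ θ := le_trans (by positivity) hθ1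
  have habs : |φ| ≤ θ := by
    refine le_trans ?_ hθ1
    rw [hφ, abs_div, abs_mul, abs_mul, abs_of_pos Real.pi_pos, abs_of_nonneg ha,
      abs_of_pos (by positivity : (0 : ℝ) < 2 * Lp)]
    gcongr
    rw [abs_le]
    have hl : ((l : ℕ) : ℝ) ≤ n := by exact_mod_cast Nat.lt_succ_iff.mp l.is_lt
    have hl0 : (0 : ℝ) ≤ ((l : ℕ) : ℝ) := by positivity
    constructor <;> linarith
  have hcos : Real.cos θ ≤ Real.cos φ := by
    rw [← Real.cos_abs φ]
    exact Real.cos_le_cos_of_nonneg_of_le_pi (abs_nonneg _) (by linarith [Real.pi_pos]) habs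
  have hcos0 : 0 ≤ Real.cos θ := Real.cos_nonneg_of_mem_Icc ⟨by linarith [Real.pi_pos], hθ2⟩
  nlinarith [hcos, hcos0]

/-- Hence `S_{n+1} ≥ 4cos²θ · H_{n+1}`. [folklore] -/
theorem rodHarmonic_ge (hLp : 0 < Lp) (ha : 0 ≤ a) {θ : ℝ}
    (hθ1 : π * n * a / (2 * Lp) ≤ θ) (hθ2 : θ ≤ π / 2) :
    4 * Real.cos θ ^ 2 * ∑ j ∈ Finset.range (n + 1), 1 / ((j : ℝ) + 1) ≤ rodHarmonic n Lp a := by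
  unfold rodHarmonic
  rw [Finset.mul_sum, ← Fin.sum_univ_eq_sum_range (fun j => 4 * Real.cos θ ^ 2 * (1 / ((j : ℝ) + 1)))]
  refine Finset.sum_le_sum fun l _ => ?_
  rw [mul_one_div, div_le_div_iff_of_pos_right (by positivity)]
  exact norm_sq_one_add_rodPhase_ge hLp ha hθ1 hθ2 l

/-! #### The majorant and the pointwise domination on the whole `t`-range -/

/-- The real harmonic number `H_{n+1} = ∑_{j ≤ n} 1/(j+1)` in the range form consumed by
`Real.tendsto_sum_range_one_div_nat_succ_atTop` (equals Mathlib's `(harmonic (n+1) : ℝ)`; kept as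
a local abbreviation for the divergence proof of the rod majorant). [folklore] -/
abbrev rodHarmonicNumber (n : ℕ) : ℝ := ∑ j ∈ Finset.range (n + 1), 1 / ((j : ℝ) + 1)

/-- `H_{n+1} ≥ 0` for the rod harmonic abbreviation. [folklore] -/
theorem rodHarmonicNumber_nonneg (n : ℕ) : 0 ≤ rodHarmonicNumber n :=
  Finset.sum_nonneg fun j _ => by positivity

/-- The **rod majorant** on the `t`-range `[0, L' + a]`:
`M(t) = exp(−sin²(π(t−a)/L') cos²θ H_{n+1}/(36π²))` on `[a, L']`, and `1` on the edge pieces.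
[folklore] -/
def rodMajorant (n : ℕ) (Lp a θ t : ℝ) : ℝ :=
  if a ≤ t ∧ t ≤ Lp then
    Real.exp (-(Real.sin (π * (t - a) / Lp) ^ 2 * (Real.cos θ ^ 2 * rodHarmonicNumber n) / (36 * π ^ 2)))
  else 1

/-- `0 ≤ M ≤ 1`. [folklore] -/
theorem rodMajorant_nonneg (n : ℕ) (Lp a θ t : ℝ) : 0 ≤ rodMajorant n Lp a θ t := by
  unfold rodMajorant; split_ifs
  · exact (Real.exp_pos _).le
  · exact zero_le_one

/-- `M ≤ 1`. [folklore] -/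
theorem rodMajorant_le_one (n : ℕ) (Lp a θ t : ℝ) : rodMajorant n Lp a θ t ≤ 1 := by
  unfold rodMajorant; split_ifs
  · rw [Real.exp_le_one_iff, neg_nonpos]
    exact div_nonneg (mul_nonneg (sq_nonneg _) (mul_nonneg (sq_nonneg _) (rodHarmonicNumber_nonneg n)))
      (by positivity)
  · exact le_rfl

/-- `M` is measurable. [folklore] -/
theorem measurable_rodMajorant (n : ℕ) (Lp a θ : ℝ) : Measurable (rodMajorant n Lp a θ) := by
  unfold rodMajorant
  refine Measurable.ite ?_ (by fun_prop) measurable_const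
  exact measurableSet_Icc

/-- **Pointwise domination on the whole `t`-range.** For `0 ≤ a ≤ L'`, `πna/(2L') ≤ θ ≤ π/2` and
`t ∈ [0, L' + a]`: `ρ̃_{n+1}(t) ≤ ((n+1)/L') e^{1/2} M(t)`. [folklore] -/
theorem rodCompressedDensity_le_rodMajorant (hLp : 0 < Lp) (ha : 0 ≤ a) (haL : a ≤ Lp) {θ : ℝ}
    (hθ1 : π * n * a / (2 * Lp) ≤ θ) (hθ2 : θ ≤ π / 2) (ht : t ∈ Set.Icc 0 (Lp + a)) :
    rodCompressedDensity n Lp a t ≤ (n + 1 : ℝ) / Lp * Real.exp (1 / 2) * rodMajorant n Lp a θ t := by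
  unfold rodMajorant
  by_cases hmain : a ≤ t ∧ t ≤ Lp
  · rw [if_pos hmain]
    refine (rodCompressedDensity_le hLp ha hmain.1 hmain.2).trans ?_
    have h14 : Real.exp (1 / 4) ≤ Real.exp (1 / 2) := Real.exp_le_exp.mpr (by norm_num)
    have hS := rodHarmonic_ge hLp ha hθ1 hθ2
    have hexp : Real.exp (-(Real.sin (π * (t - a) / Lp) ^ 2 * rodHarmonic n Lp a / (144 * π ^ 2))) ≤
        Real.exp (-(Real.sin (π * (t - a) / Lp) ^ 2 * (Real.cos θ ^ 2 * rodHarmonicNumber n) /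
          (36 * π ^ 2))) := by
      apply Real.exp_le_exp.mpr
      unfold rodHarmonicNumber
      have hs0 : 0 ≤ Real.sin (π * (t - a) / Lp) ^ 2 := sq_nonneg _
      have hpi : 0 < π ^ 2 := by positivity
      rw [neg_le_neg_iff, div_le_div_iff₀ (by positivity) (by positivity)]
      nlinarith [mul_le_mul_of_nonneg_left hS hs0]
    exact mul_le_mul (mul_le_mul_of_nonneg_left h14 (by positivity)) hexp (by positivity)
      (by positivity)
  · rw [if_neg hmain, mul_one]
    rw [not_and_or, not_le, not_le] at hmain
    rcases hmain with hlt | hgt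
    · exact (rodCompressedDensity_le_edge_left ht.1 hlt).trans
        (girardeauDensityMatrix_le_crude hLp ⟨ht.1, by linarith⟩)
    · exact (rodCompressedDensity_le_edge_right hgt ht.2).trans
        (girardeauDensityMatrix_le_crude hLp ⟨by linarith, by linarith [ht.2]⟩)

/-! #### The majorant integral tends to zero -/

/-- `∫₀^{L'+a} M ≤ 2a + L' ∫₀¹ exp(−sin²(πv) cos²θ H_{n+1}/(36π²)) dv` (the edge pieces have length
`2a`; substitution `t = a + L'v` on `[a, L']`). [folklore] -/
theorem integral_rodMajorant_le (hLp : 0 < Lp) (ha : 0 ≤ a) (haL : a ≤ Lp) (θ : ℝ) :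
    ∫ t in Set.Icc 0 (Lp + a), rodMajorant n Lp a θ t ≤
      2 * a + Lp * ∫ v in Set.Icc (0 : ℝ) 1,
        Real.exp (-(Real.sin (π * v) ^ 2 * (Real.cos θ ^ 2 * rodHarmonicNumber n) / (36 * π ^ 2))) := by
  set K : ℝ := Real.cos θ ^ 2 * rodHarmonicNumber n with hK
  set G : ℝ → ℝ := fun v => Real.exp (-(Real.sin (π * v) ^ 2 * K / (36 * π ^ 2))) with hG
  have hGc : Continuous G := by rw [hG]; fun_prop
  have hG0 : ∀ v, 0 ≤ G v := fun v => (Real.exp_pos _).le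
  have hM_int : ∀ u w : ℝ, IntervalIntegrable (rodMajorant n Lp a θ) volume u w := by
    intro u w
    refine IntegrableOn.intervalIntegrable ?_
    have h1 : IntegrableOn (fun _ => (1 : ℝ)) (Set.uIcc u w) volume := continuous_const.integrableOn_Icc
    exact h1.mono' (measurable_rodMajorant n Lp a θ).aestronglyMeasurable
      (Filter.Eventually.of_forall fun t => by
        rw [Real.norm_eq_abs, abs_of_nonneg (rodMajorant_nonneg _ _ _ _ _)]
        exact rodMajorant_le_one _ _ _ _ _)
  -- rewrite as interval integrals and split at `a` and `L'`
  rw [integral_Icc_eq_integral_Ioc, ← intervalIntegral.integral_of_le (by linarith),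
    ← intervalIntegral.integral_add_adjacent_intervals (hM_int 0 a) (hM_int a (Lp + a)),
    ← intervalIntegral.integral_add_adjacent_intervals (hM_int a Lp) (hM_int Lp (Lp + a))]
  -- the edge pieces are at most their length
  have hedge : ∀ u w : ℝ, u ≤ w → ∫ t in u..w, rodMajorant n Lp a θ t ≤ w - u := by
    intro u w huw
    have := intervalIntegral.integral_mono_on huw (hM_int u w) (by simp)
      (fun t _ => rodMajorant_le_one n Lp a θ t)
    simpa using this
  have h1 := hedge 0 a ha
  have h3 := hedge Lp (Lp + a) (by linarith)
  -- the middle piece: `M = G((t − a)/L')` on `[a, L']`, substitution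
  have hmid : ∫ t in a..Lp, rodMajorant n Lp a θ t ≤ Lp * ∫ v in Set.Icc (0 : ℝ) 1, G v := by
    have heq : ∫ t in a..Lp, rodMajorant n Lp a θ t = ∫ t in a..Lp, G (t / Lp - a / Lp) := by
      refine intervalIntegral.integral_congr fun t ht => ?_
      rw [Set.uIcc_of_le haL] at ht
      simp only [rodMajorant, if_pos (show a ≤ t ∧ t ≤ Lp from ⟨ht.1, ht.2⟩), hG]
      congr 2
      rw [show π * (t / Lp - a / Lp) = π * (t - a) / Lp by field_simp]
    have hsub : ∫ t in a..Lp, G (t / Lp - a / Lp) = Lp * ∫ v in (0 : ℝ)..(1 - a / Lp), G v := by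
      rw [intervalIntegral.integral_comp_div_sub (f := G) hLp.ne', smul_eq_mul, sub_self,
        div_self hLp.ne']
    have h01 : (0 : ℝ) ≤ 1 - a / Lp := by
      rw [sub_nonneg]
      exact (div_le_one hLp).mpr haL
    have hmono : ∫ v in (0 : ℝ)..(1 - a / Lp), G v ≤ ∫ v in Set.Icc (0 : ℝ) 1, G v := by
      rw [intervalIntegral.integral_of_le h01, ← integral_Icc_eq_integral_Ioc]
      exact setIntegral_mono_set hGc.integrableOn_Icc (Filter.Eventually.of_forall hG0)
        (Filter.Eventually.of_forall (Set.Icc_subset_Icc le_rfl (by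
          rw [sub_le_self_iff]; exact div_nonneg ha hLp.le)))
    rw [heq, hsub]
    exact mul_le_mul_of_nonneg_left hmono hLp.le
  linarith

/-- Dominated convergence: `∫₀¹ exp(−sin²(πv) K_n) dv → 0` when `K_n → ∞`. [folklore] -/
theorem tendsto_integral_exp_neg_sin_sq (K : ℕ → ℝ) (hK0 : ∀ m, 0 ≤ K m)
    (hK : Tendsto K atTop atTop) :
    Tendsto (fun m => ∫ v in Set.Icc (0 : ℝ) 1, Real.exp (-(Real.sin (π * v) ^ 2 * K m)))
      atTop (𝓝 0) := by
  have hbad : ({v : ℝ | Real.sin (π * v) = 0}).Countable := by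
    have : {v : ℝ | Real.sin (π * v) = 0} ⊆ Set.range fun k : ℤ => (k : ℝ) := by
      intro v hv
      obtain ⟨k, hk⟩ := Real.sin_eq_zero_iff.mp hv
      refine ⟨k, ?_⟩
      have : (k : ℝ) * π / π = π * v / π := by rw [hk]
      rwa [mul_div_assoc, div_self Real.pi_pos.ne', mul_one, mul_comm, mul_div_assoc,
        div_self Real.pi_pos.ne', mul_one] at this
    exact (Set.countable_range _).mono this
  have hae : ∀ᵐ v ∂(volume.restrict (Set.Icc (0 : ℝ) 1)),
      Tendsto (fun m => Real.exp (-(Real.sin (π * v) ^ 2 * K m))) atTop (𝓝 0) := by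
    have h0 : (volume.restrict (Set.Icc (0 : ℝ) 1)) {v : ℝ | Real.sin (π * v) = 0} = 0 :=
      hbad.measure_zero _
    filter_upwards [compl_mem_ae_iff.mpr h0] with v hv
    simp only [Set.mem_compl_iff, Set.mem_setOf_eq] at hv
    have hc : 0 < Real.sin (π * v) ^ 2 := by positivity
    have h1 : Tendsto (fun m => Real.sin (π * v) ^ 2 * K m) atTop atTop :=
      Tendsto.const_mul_atTop hc hK
    exact Real.tendsto_exp_comp_nhds_zero.mpr (tendsto_neg_atTop_atBot.comp h1)
  have h := tendsto_integral_of_dominated_convergence (μ := volume.restrict (Set.Icc (0 : ℝ) 1))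
    (F := fun m v => Real.exp (-(Real.sin (π * v) ^ 2 * K m))) (f := fun _ => 0) (fun _ => 1)
    (fun m => Continuous.aestronglyMeasurable (by fun_prop))
    (integrable_const _)
    (fun m => Filter.Eventually.of_forall fun v => by
      rw [Real.norm_eq_abs, abs_of_nonneg (Real.exp_pos _).le, Real.exp_le_one_iff, neg_nonpos]
      exact mul_nonneg (sq_nonneg _) (hK0 m))
    hae
  simpa using h

/-- **The majorant integral vanishes in the thermodynamic limit.** Along `L'_n = (n+1)ℓ`
(`ℓ = 1/ρ − a > 0`), with `0 ≤ a`, `cos θ ≠ 0`: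
`L'_n⁻¹ ∫₀^{L'_n + a} M_n → 0`. [folklore] -/
theorem tendsto_rodMajorant_integral {ℓ : ℝ} (hℓ : 0 < ℓ) (ha : 0 ≤ a) {θ : ℝ} (hθ : Real.cos θ ≠ 0) :
    Tendsto (fun n : ℕ => ((n + 1 : ℝ) * ℓ)⁻¹ *
      ∫ t in Set.Icc 0 ((n + 1 : ℝ) * ℓ + a), rodMajorant n ((n + 1 : ℝ) * ℓ) a θ t) atTop (𝓝 0) := by
  -- the two terms of the bound
  set K : ℕ → ℝ := fun n => Real.cos θ ^ 2 * rodHarmonicNumber n / (36 * π ^ 2) with hKdef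
  have hK0 : ∀ m, 0 ≤ K m := fun m => by
    rw [hKdef]; exact div_nonneg (mul_nonneg (sq_nonneg _) (rodHarmonicNumber_nonneg m)) (by positivity)
  have hKt : Tendsto K atTop atTop := by
    have hc : 0 < Real.cos θ ^ 2 / (36 * π ^ 2) := by positivity
    have hH : Tendsto (fun n => rodHarmonicNumber n) atTop atTop := by
      unfold rodHarmonicNumber
      exact (Real.tendsto_sum_range_one_div_nat_succ_atTop.comp (tendsto_add_atTop_nat 1))
    have := Tendsto.const_mul_atTop hc hH
    refine this.congr fun n => ?_
    rw [hKdef]; ring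
  have hI := tendsto_integral_exp_neg_sin_sq K hK0 hKt
  have hedge : Tendsto (fun n : ℕ => 2 * a * ((n + 1 : ℝ) * ℓ)⁻¹) atTop (𝓝 0) := by
    have h1 : Tendsto (fun n : ℕ => ((n + 1 : ℝ) * ℓ)) atTop atTop := by
      refine Tendsto.atTop_mul_const hℓ ?_
      exact tendsto_atTop_add_const_right _ 1 tendsto_natCast_atTop_atTop
    simpa using (tendsto_inv_atTop_zero.comp h1).const_mul (2 * a)
  have hsum : Tendsto (fun n : ℕ => 2 * a * ((n + 1 : ℝ) * ℓ)⁻¹ +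
      ∫ v in Set.Icc (0 : ℝ) 1, Real.exp (-(Real.sin (π * v) ^ 2 * K n))) atTop (𝓝 0) := by
    simpa using hedge.add hI
  refine tendsto_of_tendsto_of_tendsto_of_le_of_le' tendsto_const_nhds hsum ?_ ?_
  · exact Filter.Eventually.of_forall fun n => mul_nonneg (by positivity)
      (integral_nonneg fun t => rodMajorant_nonneg _ _ _ _ _)
  · have hev : ∀ᶠ n : ℕ in atTop, a ≤ (n + 1 : ℝ) * ℓ := by
      have h1 : Tendsto (fun n : ℕ => ((n + 1 : ℝ) * ℓ)) atTop atTop := by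
        refine Tendsto.atTop_mul_const hℓ ?_
        exact tendsto_atTop_add_const_right _ 1 tendsto_natCast_atTop_atTop
      exact h1.eventually_ge_atTop a
    filter_upwards [hev] with n hn
    have hLp : 0 < (n + 1 : ℝ) * ℓ := by positivity
    have hb := integral_rodMajorant_le (n := n) hLp ha hn θ
    have hKn : ∀ v, Real.exp (-(Real.sin (π * v) ^ 2 * (Real.cos θ ^ 2 * rodHarmonicNumber n) /
        (36 * π ^ 2))) = Real.exp (-(Real.sin (π * v) ^ 2 * K n)) := by
      intro v
      show _ = Real.exp (-(Real.sin (π * v) ^ 2 * (Real.cos θ ^ 2 * rodHarmonicNumber n / (36 * π ^ 2))))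
      congr 1
      ring
    simp_rw [hKn] at hb
    calc ((n + 1 : ℝ) * ℓ)⁻¹ * ∫ t in Set.Icc 0 ((n + 1 : ℝ) * ℓ + a), rodMajorant n ((n + 1 : ℝ) * ℓ) a θ t
        ≤ ((n + 1 : ℝ) * ℓ)⁻¹ * (2 * a + (n + 1 : ℝ) * ℓ *
            ∫ v in Set.Icc (0 : ℝ) 1, Real.exp (-(Real.sin (π * v) ^ 2 * K n))) :=
          mul_le_mul_of_nonneg_left hb (inv_nonneg.mpr hLp.le)
      _ = 2 * a * ((n + 1 : ℝ) * ℓ)⁻¹ +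
            ∫ v in Set.Icc (0 : ℝ) 1, Real.exp (-(Real.sin (π * v) ^ 2 * K n)) := by
          rw [mul_add, ← mul_assoc, ← mul_assoc, inv_mul_cancel₀ hLp.ne', one_mul]
          ring

end Majorant

end Literature.Barriers.AtomisticToContinuum.BoseGas

end
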